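import Mathlib
import HarnessLib

/-!
# Item `LrcModEntire` (stmt-NavierStokesRegularity-20428), skeleton twist_split v6 — T1 cell, step (I), JET stub: GENERIC JET TOOLS
# (line restrictions ↔ `iteratedFDeriv` along a vector, commutation `∂ᵤ∂ₑᵐ = ∂ₑᵐ∂ᵤ` for analytic maps, flat analytic functions of one variable are constant,
# lowest-order Leibniz rule)

Cell ns-regularity-ideate, seat ns-k2-port-2 g4 (free hand; `--supports stmt-NavierStokesRegularity-20428 --as helper`).  Tools for the sub-steps (Z) «z-jets at the
thread plane», (S) «differentiate `ω_z ≡ 0`, `div v ≡ 0` in `z`», (T) «leading order of the bilinear (TH) identity (Leibniz, lower terms vanish)» and (E) «all jets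
vanish ⇒ the analytic slice is constant in `z`» of `stub_flatPlane_badData` (LEAD ns-poloidal-K2-p3 g13, `Cruxes/LrcModEntire/T1StepI.lean`, dossier CELLS-TH-g13 §2ter):

* `iteratedDeriv_lineRestrict` — `(d/ds)ᵐ f(x + s·e) = Dᵐf(x + s·e)(e,…,e)` (`f ∈ Cᴺ`, `m ≤ N`);  `analyticOnNhd_lineRestrict`;
* `iteratedFDeriv_clm_apply`, `iteratedFDeriv_coord` — jets commute with a continuous linear map / with taking a coordinate;
* `fderiv_jet_apply` — **`∂ᵤ[x ↦ Dᵐf(x)(e,…,e)] = Dᵐ[x ↦ ∂ᵤf(x)](e,…,e)`** for `f` analytic (symmetry of `Dᵐ⁺¹f`, Mathlib `AnalyticOn.iteratedFDeriv_comp_perm`);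
* `eq_of_iteratedDeriv_eq_zero` — an entire real-analytic `g : ℝ → F` with `g⁽ᵏ⁾(z₀) = 0` for all `k ≥ 1` is constant (`analyticOrderAt = ⊤` + identity theorem);
* `iteratedDeriv_mul_eq_zero_of_lt`, `iteratedDeriv_mul_lowest` — if `f⁽ⁱ⁾(x) = 0 (i < j)` and `g⁽ⁱ⁾(x) = 0 (i < k)` then `(fg)⁽ⁿ⁾(x) = 0` for `n < j + k` and
  `(fg)⁽ʲ⁺ᵏ⁾(x) = C(j+k, j)·f⁽ʲ⁾(x)·g⁽ᵏ⁾(x)`.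

WHAT THIS IS NOT: not a claim about Navier–Stokes regularity — generic calculus (bears_on LADDER-NS N0, item 20428 / crux 19708; both OPEN).
-/

noncomputable section

-- the summit and its single sub-problem share the name (CONVENTIONS §1), as in every Theorems file
set_option linter.dupNamespace false

namespace Summit.NavierStokesRegularity.NavierStokesRegularity.Theorems.PoloidalWindowDoorLrcModEntireTwistingTHJetTools

open Set Function Filter Topology
open scoped Topology ContDiff

/-- `update (const e) 0 u` and `update (const e) (last m) u` differ by the transposition `(0 last)`. -/
theorem update_zero_eq_update_last_comp_swap {α : Type*} {m : ℕ} (e u : α) :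
    Function.update (fun _ : Fin (m + 1) => e) 0 u = Function.update (fun _ : Fin (m + 1) => e) (Fin.last m) u ∘ Equiv.swap 0 (Fin.last m) := by
  rw [Function.update_comp_equiv]
  congr 1
  simp [Equiv.swap_apply_right]

section LineRestrict

variable {E F : Type*} [NormedAddCommGroup E] [NormedSpace ℝ E] [NormedAddCommGroup F] [NormedSpace ℝ F]

/-- **Line restriction ↔ Fréchet jet**: `(d/ds)ᵐ f(x + s·e) |_{s} = Dᵐ f(x + s·e)(e, …, e)` for `f ∈ Cᴺ`, `m ≤ N`. -/
theorem iteratedDeriv_lineRestrict {f : E → F} {N : WithTop ℕ∞} (hf : ContDiff ℝ N f) (x e : E) {m : ℕ} (hm : (m : WithTop ℕ∞) ≤ N) (s : ℝ) :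
    iteratedDeriv m (fun s : ℝ => f (x + s • e)) s = iteratedFDeriv ℝ m f (x + s • e) (fun _ => e) := by
  set g : ℝ →L[ℝ] E := (ContinuousLinearMap.id ℝ ℝ).smulRight e with hg
  have hg1 : ∀ t : ℝ, g t = t • e := fun t => by simp [hg]
  have hF : ContDiff ℝ N (fun y : E => f (x + y)) := hf.comp (contDiff_const.add contDiff_id)
  have hcomp : (fun s : ℝ => f (x + s • e)) = (fun y : E => f (x + y)) ∘ g := by
    funext t; simp [hg1]
  rw [iteratedDeriv_eq_iteratedFDeriv, hcomp, g.iteratedFDeriv_comp_right hF s hm,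
    ContinuousMultilinearMap.compContinuousLinearMap_apply, iteratedFDeriv_comp_add_left, hg1]
  congr 1
  funext i
  simp [hg1]

/-- The line restriction of an entire analytic map is an entire analytic function of one variable. -/
theorem analyticOnNhd_lineRestrict {f : E → F} (hf : AnalyticOnNhd ℝ f univ) (x e : E) :
    AnalyticOnNhd ℝ (fun s : ℝ => f (x + s • e)) univ := by
  intro s _
  have hlin : AnalyticAt ℝ (fun t : ℝ => t • e) s := by
    have h := ((ContinuousLinearMap.id ℝ ℝ).smulRight e).analyticAt s
    exact h.congr (Filter.Eventually.of_forall fun t => by simp)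
  have hin : AnalyticAt ℝ (fun t : ℝ => x + t • e) s := analyticAt_const.add hlin
  exact AnalyticAt.comp (g := f) (f := fun t : ℝ => x + t • e) (x := s) (hf _ (mem_univ _)) hin

/-- Jets commute with a continuous linear map on the target: `Dᵐ(L ∘ f)(x)(v) = L (Dᵐf(x)(v))`. -/
theorem iteratedFDeriv_clm_apply {G : Type*} [NormedAddCommGroup G] [NormedSpace ℝ G] {f : E → F} {N : WithTop ℕ∞} (hf : ContDiff ℝ N f)
    (L : F →L[ℝ] G) (x : E) {m : ℕ} (hm : (m : WithTop ℕ∞) ≤ N) (v : Fin m → E) :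
    iteratedFDeriv ℝ m (fun y => L (f y)) x v = L (iteratedFDeriv ℝ m f x v) := by
  have h := L.iteratedFDeriv_comp_left (hf.contDiffAt (x := x)) hm
  rw [show (fun y => L (f y)) = L ∘ f from rfl, h]
  rfl

/-- Jets commute with taking a coordinate: `Dᵐ(x ↦ f(x)ᵢ)(v) = (Dᵐf(x)(v))ᵢ` (`f` with values in `ℝⁿ`). -/
theorem iteratedFDeriv_coord {n : ℕ} {f : E → EuclideanSpace ℝ (Fin n)} {N : WithTop ℕ∞} (hf : ContDiff ℝ N f) (i : Fin n) (x : E) {m : ℕ}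
    (hm : (m : WithTop ℕ∞) ≤ N) (v : Fin m → E) :
    iteratedFDeriv ℝ m (fun y => f y i) x v = (iteratedFDeriv ℝ m f x v) i := by
  have h := iteratedFDeriv_clm_apply hf (EuclideanSpace.proj i) x hm v
  simpa using h

end LineRestrict

section Commute

variable {E F : Type*} [NormedAddCommGroup E] [NormedSpace ℝ E] [NormedAddCommGroup F] [NormedSpace ℝ F]

/-- **`∂ᵤ ∂ₑᵐ = ∂ₑᵐ ∂ᵤ` for analytic maps**: `∂ᵤ[x ↦ Dᵐf(x)(e,…,e)] = Dᵐ[x ↦ Df(x)u](e,…,e)`. -/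
theorem fderiv_jet_apply {f : E → F} (hf : AnalyticOnNhd ℝ f univ) (m : ℕ) (x e u : E) :
    fderiv ℝ (fun y => iteratedFDeriv ℝ m f y (fun _ => e)) x u = iteratedFDeriv ℝ m (fun y => fderiv ℝ f y u) x (fun _ => e) := by
  have hω : ContDiff ℝ ω f := hf.contDiff
  -- left side = D^{m+1} f x (u, e, …, e)
  have hdiff : DifferentiableAt ℝ (iteratedFDeriv ℝ m f) x :=
    (hω.contDiffAt (x := x)).differentiableAt_iteratedFDeriv (by exact_mod_cast WithTop.coe_lt_top (m : ℕ∞))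
  have h1 : fderiv ℝ (fun y => iteratedFDeriv ℝ m f y (fun _ => e)) x u = (fderiv ℝ (iteratedFDeriv ℝ m f) x u) (fun _ => e) :=
    fderiv_continuousMultilinear_apply_const_apply hdiff _ _
  have h2 : iteratedFDeriv ℝ (m + 1) f x (Function.update (fun _ => e) 0 u) = (fderiv ℝ (iteratedFDeriv ℝ m f) x u) (fun _ => e) := by
    rw [iteratedFDeriv_succ_apply_left, Function.update_self]
    congr 1
  -- right side = D^{m+1} f x (e, …, e, u)
  have h3 : iteratedFDeriv ℝ (m + 1) f x (Function.update (fun _ => e) (Fin.last m) u) =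
      iteratedFDeriv ℝ m (fun y => fderiv ℝ f y) x (fun _ => e) u := by
    rw [iteratedFDeriv_succ_apply_right, Function.update_self]
    congr 2
    funext j
    simp [Fin.init]
  have h4 : iteratedFDeriv ℝ m (fun y => fderiv ℝ f y u) x (fun _ => e) = iteratedFDeriv ℝ m (fun y => fderiv ℝ f y) x (fun _ => e) u := by
    have hD : ContDiff ℝ ω (fun y => fderiv ℝ f y) := hω.fderiv_right (m := ω) le_rfl
    have h := iteratedFDeriv_clm_apply hD (ContinuousLinearMap.apply ℝ F u) x (m := m) (by exact_mod_cast le_top) (fun _ => e)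
    simpa using h
  -- symmetry of D^{m+1} f x
  have hsymm : iteratedFDeriv ℝ (m + 1) f x (Function.update (fun _ => e) 0 u) = iteratedFDeriv ℝ (m + 1) f x (Function.update (fun _ => e) (Fin.last m) u) := by
    rw [update_zero_eq_update_last_comp_swap e u]
    exact hf.analyticOn.iteratedFDeriv_comp_perm _ _
  rw [h1, ← h2, hsymm, h3, h4]

end Commute

section OneVariable

variable {F : Type*} [NormedAddCommGroup F] [NormedSpace ℝ F] [CompleteSpace F]

/-- **A flat entire analytic function of one real variable is constant**: `g` analytic on `ℝ`, `g⁽ᵏ⁾(z₀) = 0` for all `k ≥ 1` ⇒ `g ≡ g(z₀)`. -/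
theorem eq_of_iteratedDeriv_eq_zero {g : ℝ → F} (hg : AnalyticOnNhd ℝ g univ) {z₀ : ℝ} (h : ∀ k : ℕ, 1 ≤ k → iteratedDeriv k g z₀ = 0) :
    ∀ z, g z = g z₀ := by
  set hfun : ℝ → F := fun z => g z - g z₀ with hdef
  have hha : AnalyticOnNhd ℝ hfun univ := hg.sub analyticOnNhd_const
  have hder : ∀ k : ℕ, iteratedDeriv k hfun z₀ = 0 := by
    intro k
    cases k with
    | zero => simp [hdef]
    | succ k =>
        have hd : deriv hfun = deriv g := by
          funext z
          simp only [hdef]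
          exact deriv_sub_const (g z₀)
        rw [iteratedDeriv_succ', hd, ← iteratedDeriv_succ']
        exact h (k + 1) (by omega)
  have htop : analyticOrderAt hfun z₀ = ⊤ := by
    rw [ENat.eq_top_iff_forall_ge]
    intro n
    exact (natCast_le_analyticOrderAt_iff_iteratedDeriv_eq_zero (hha z₀ (mem_univ _))).mpr fun i _ => hder i
  have hev : hfun =ᶠ[𝓝 z₀] (fun _ => (0 : F)) := analyticOrderAt_eq_top.mp htop
  have hzero : hfun = fun _ => (0 : F) := AnalyticOnNhd.eq_of_eventuallyEq hha analyticOnNhd_const hev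
  intro z
  have := congrFun hzero z
  simp only [hdef] at this
  exact sub_eq_zero.mp this

/-- **Lowest-order Leibniz rule, vanishing part**: `f⁽ⁱ⁾(x) = 0 (i < j)`, `g⁽ⁱ⁾(x) = 0 (i < k)`, `n < j + k` ⇒ `(fg)⁽ⁿ⁾(x) = 0`. -/
theorem iteratedDeriv_mul_eq_zero_of_lt {f g : ℝ → ℝ} {x : ℝ} {j k n : ℕ} (hf : ContDiffAt ℝ n f x) (hg : ContDiffAt ℝ n g x)
    (hfj : ∀ i < j, iteratedDeriv i f x = 0) (hgk : ∀ i < k, iteratedDeriv i g x = 0) (hn : n < j + k) :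
    iteratedDeriv n (f * g) x = 0 := by
  rw [iteratedDeriv_mul hf hg]
  refine Finset.sum_eq_zero fun i hi => ?_
  rw [Finset.mem_range] at hi
  by_cases hij : i < j
  · rw [hfj i hij]; ring
  · rw [hgk (n - i) (by omega)]; ring

/-- **Lowest-order Leibniz rule, leading term**: `f⁽ⁱ⁾(x) = 0 (i < j)`, `g⁽ⁱ⁾(x) = 0 (i < k)` ⇒ `(fg)⁽ʲ⁺ᵏ⁾(x) = C(j+k, j)·f⁽ʲ⁾(x)·g⁽ᵏ⁾(x)`. -/
theorem iteratedDeriv_mul_lowest {f g : ℝ → ℝ} {x : ℝ} {j k : ℕ} (hf : ContDiffAt ℝ (j + k : ℕ) f x) (hg : ContDiffAt ℝ (j + k : ℕ) g x)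
    (hfj : ∀ i < j, iteratedDeriv i f x = 0) (hgk : ∀ i < k, iteratedDeriv i g x = 0) :
    iteratedDeriv (j + k) (f * g) x = ((j + k).choose j : ℝ) * iteratedDeriv j f x * iteratedDeriv k g x := by
  rw [iteratedDeriv_mul hf hg, Finset.sum_eq_single j]
  · rw [Nat.add_sub_cancel_left]
  · intro i hi hij
    rw [Finset.mem_range] at hi
    by_cases h : i < j
    · rw [hfj i h]; ring
    · rw [hgk (j + k - i) (by omega)]; ring
  · intro h
    exact absurd (Finset.mem_range.mpr (by omega)) h

end OneVariable

end Summit.NavierStokesRegularity.NavierStokesRegularity.Theorems.PoloidalWindowDoorLrcModEntireTwistingTHJetTools
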